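import Literature.AlgebraicGeometry.AbelianSchemes.MumfordBundleClassifierBaseChange
import Literature.AlgebraicGeometry.AbelianSchemes.AbelianSchemeLDeltaOfLambdaGlobal
import Literature.AlgebraicGeometry.AbelianSchemes.IsLambdaOfAtAlongIsogeny
import Literature.AlgebraicGeometry.AbelianSchemes.AbelianSchemeOverHomEqOfGeometricFibres
import HarnessLib

/-!
# Prop. 6.11 for POLARISATIONS: if `L_T ≅ L^Δ_T(ω^k)` for a polarisation `ω` of `A_T`, then `Λ(L)_T = 2k·ω` automatically
# ([MumfordFogartyKirwan1994] Ch. 6 §2 Prop. 6.11, uniqueness half «By Proposition 6.10, `2kλ₁ = 2kλ₂`», and Ch. 7 §2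
# Prop. 7.3 step (V) «that polarization `ω̄_S` must satisfy `L′₄ ⊗ 𝒪_S ≅ L^Δ(ω̄_S)^3`») — ANY locally Noetherian `T`

Layer `Literature/AlgebraicGeometry/AbelianSchemes`, namespace `Literature.AlgebraicGeometry.AbelianSchemes.AbelianSchemeOver`.
THEOREMS ONLY (no definition, no named fact, no instance, no notation, no `sorry`).  Cell `hodgecm-mathlib` (D-0151), F-DAG row
F-2 (e) «MFK Prop. 6.11», brick B3d of B-p17 (g12).  ★ `exists_isClosedImmersion_iff_exists_LDelta` (`AbelianSchemeLDeltaLocusClosed`,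
the HOMOMORPHISM FORM of Prop. 6.11) characterises the closed subscheme `S₀ ↪ S` by: `T → S` factors through `S₀` iff there is a
homomorphism `m : A_T → Â_T` with `[2k] ≫ m = Λ(L)_T` AND `L_T ≅ L^Δ_T(m^k)`.  This file removes the first clause when `m = ω` is
`Λ(𝒪(Θ))` at one geometric point of a connected locally Noetherian `T` (§1), or at EVERY geometric point of ANY locally Noetherian
`T` (§2) — in particular when `ω` is a POLARISATION of `A_T` (§3) — which is the direction Prop. 7.3 step (V) uses to put a polarized
abelian scheme INTO `H₅`: for polarisations, «`L_T ≅ L^Δ_T(ω^k)`» alone implies that `T → S` factors through `S₀`.  (The converse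
refinement «the descended `μ` is `k` times a polarisation» is [MumfordAV1970] §23 Thm. 3 and is not in the tree; it is not used here.)
HC_CM is proved only modulo the 7 printed citations until rung 0 closes; nothing here is about HC.

EDITION (α-5 of B-p17 (g12)'s census `B-provers/B-p17/g12/CENSUS-F6V-LDeltaCubeLocus.B-p17g12.md` §3, bytes B-p17 (g13); in-place
upgrade per B-plan1 (g16) 2026-08-30T07:57:00Z, no declaration removed or renamed): §2 is NEW, and the polarisation corollaries of §3
DROP the binders `[PreconnectedSpace T] [Nonempty T]` of the first edition — the moduli bases of Prop. 7.3 (`H₄`, and the test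
schemes `T` over it) are not connected.  The connected one-point head of §1 is kept verbatim.

SETTING.  `A/S` an abelian scheme (ANY base `S`), `D = (Â, 𝒫)` a dual pair, `L` a rank-one module on `A` rigidified along `ε_A`
(`hε`, class form) and `lam : A → Â` a homomorphism classifying the Mumford family of `L` (hypothesis (ii) of ★
`exists_isMonHom_classify_mumfordBundle`; e.g. `lam = λ_L` of ★ p758163).  Over `b : T ⟶ S` with `T` locally Noetherian:
`A_T = A.baseChange b` (`pr : A_T → A`), the base-changed dual pair ★ `D.baseChange b = (Â_T, 𝒫_T)`, a homomorphism
`ω : A_T → Â_T`, `k : ℕ`, and `Γ = (pr, ω^k ≫ pr_Â) : A_T → A ×_S Â` (given by its projections), so that `Γ^*𝒫 = L^Δ_T(ω^k)`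
([MumfordFogartyKirwan1994] p. 121 «`L^Δ(λ) = (1_X, λ)^*(𝓛)`», through `A_T ×_T Â_T → A ×_S Â`).

* §0 `isMonHom_pow'` (private), **`nonempty_mumfordBundle_iso_of_nonempty_iso`** — `Λ(M) ≅ Λ(M′)` for `M ≅ M′` (classes).
* §1 **`pow_id_comp_eq_pullback_map_of_isLambdaOfAt`** — `T` CONNECTED: if `pr^*L ≅ Γ^*𝒫` («`L_T ≅ L^Δ_T(ω^k)`») and `ω` is
  `Λ(𝒪(Θ))` at ONE geometric point `t` of `T`, then `[2k] ≫ ω = (Over.pullback b).map lam` («`Λ(L_T) = 2k·ω`»).  PROOF = MFK's: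
  over the base `T`, `(Over.pullback b).map lam` classifies the Mumford family of `L_T` (★
  `nonempty_pullbackP_baseChange_iso_pullback_mumfordBundle`, B3d-α), and `L_T ≅ (1, ω^k)^*𝒫_T = L^Δ_T(ω^k)`; Prop. 6.10 on the
  geometric fibre at `t` for the homomorphism `ω^k` (witness `k • Θ`, ★ `IsLambdaOfAt.pow_nsmul`; ★
  `pullback_map_eq_pullback_map_mul_self`) gives `lam_T ×_T t = (ω^k·ω^k) ×_T t`, and rigidity over the connected locally Noetherian
  `T` (★ `hom_eq_of_pullback_map_eq_of_isLocallyNoetherian`, [MumfordFogartyKirwan1994] Cor. 6.2) gives `lam_T = ω^{2k} = [2k] ≫ ω`.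
* §2 **`pow_id_comp_eq_pullback_map_of_forall_isLambdaOfAt`** (HEAD of the edition) — ANY locally Noetherian `T`: the same
  conclusion when `ω` is a `Λ(𝒪(Θ_t))` at EVERY geometric point `t` of `T`; the last step is rigidity in the form «homomorphisms of
  abelian schemes agreeing on every geometric fibre are equal» (★ `hom_eq_of_forall_pullback_map_eq_of_isLocallyNoetherian_base`,
  B-p21 (g17), [MumfordFogartyKirwan1994] Cor. 6.2/6.4 at all residue points + Stein).
* §3 **`pow_id_comp_eq_pullback_map_of_polarization`**, **`exists_LDelta_of_polarization`** — the same for a polarisation `pol` of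
  `(A_T, D.baseChange b)` over ANY locally Noetherian `T` (a polarisation has an ample witness at every geometric point, ★
  `Polarization.exists_ample`); the right-hand side of ★ `exists_isClosedImmersion_iff_exists_LDelta` holds at `b` (so `b` factors
  through its closed subscheme `j : Z ↪ S`).

## References
* [MumfordFogartyKirwan1994] D. Mumford, J. Fogarty, F. Kirwan, *Geometric Invariant Theory*, 3rd ed. (1994), Ch. 6 §2
  Prop. 6.10 (p. 121), Prop. 6.11 (p. 122; proof pp. 122–123), §1 Cor. 6.2 (p. 116), Cor. 6.4 (p. 117); Ch. 7 §2 Prop. 7.3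
  (pp. 132–134), step (V).
* [MumfordAV1970] D. Mumford, *Abelian Varieties* (1970), §8 (pp. 74–75), §13 (p. 123), §23 (pp. 221–234).
* [MilneAV2008] J. S. Milne, *Abelian Varieties* (v2.00, 2008), I §8 pp. 36–37.
* [Hartshorne1977] R. Hartshorne, *Algebraic Geometry* (1977), III Ex. 4.5.
-/

-- `Scheme.Modules` / `SheafOfModules` are not reducible (as in Mathlib's `AlgebraicGeometry/Modules/Sheaf.lean`).
set_option backward.isDefEq.respectTransparency false

noncomputable section

open CategoryTheory CategoryTheory.Limits AlgebraicGeometry MonoidalCategory CartesianMonoidalCategory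
open scoped MonObj

universe u

namespace Literature.AlgebraicGeometry.AbelianSchemes

open Literature.AlgebraicGeometry.Motives Literature.AlgebraicGeometry.Modules
  Literature.AlgebraicGeometry.AbelianVarieties

namespace AbelianSchemeOver

/-! ## §0 Two generalities -/

/-- `f ^ n` is a homomorphism for a homomorphism `f` into a commutative group object (Mathlib's instances for `lift`, `μ`, `η`,
`toUnit`). [cite: MumfordFogartyKirwan1994, Ch. 6 §1 Corollary 6.5 (p. 117)] -/
private theorem isMonHom_pow' {C : Type*} [Category C] [CartesianMonoidalCategory C] [BraidedCategory C] {X M : C}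
    [MonObj X] [MonObj M] [IsCommMonObj M] (f : X ⟶ M) [IsMonHom f] (n : ℕ) : IsMonHom (f ^ n) := by
  induction n with
  | zero => rw [pow_zero, Hom.one_def]; infer_instance
  | succ n ih => rw [pow_succ, Hom.mul_def]; infer_instance

variable {S : Scheme.{u}} (A : AbelianSchemeOver S)

/-- **`Λ(M) ≅ Λ(M′)` for isomorphic line bundles `M ≅ M′`** (both Mumford bundles are line bundles with the same class
`Λ([M])`, ★ `detClass_mumfordBundle`, ★ `nonempty_iso_iff_detClass_eq`). [cite: MumfordFogartyKirwan1994, Ch. 6 §2 Definition 6.2 (p. 120)]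
[cite: Hartshorne1977, III Ex. 4.5] -/
theorem nonempty_mumfordBundle_iso_of_nonempty_iso {M M' : A.left.Modules} (hM : HasRank M 1) (hM' : HasRank M' 1)
    (h : Nonempty (M ≅ M')) : Nonempty (A.mumfordBundle M ≅ A.mumfordBundle M') := by
  obtain ⟨i⟩ := h
  refine (nonempty_iso_iff_detClass_eq (A.hasRank_mumfordBundle hM) (A.hasRank_mumfordBundle hM')
    (HasRank.isFiniteLocallyFree' (A.hasRank_mumfordBundle hM)) (HasRank.isFiniteLocallyFree' (A.hasRank_mumfordBundle hM'))).2 ?_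
  rw [A.detClass_mumfordBundle hM, A.detClass_mumfordBundle hM',
    detClass_eq_of_iso i (HasRank.isFiniteLocallyFree' hM) (HasRank.isFiniteLocallyFree' hM')]

/-! ## §1 `L_T ≅ L^Δ_T(ω^k)` with `ω` a `Λ(𝒪(Θ))` at one geometric point ⟹ `[2k] ≫ ω = Λ(L)_T` -/

variable (D : A.DualPair) {L : A.left.Modules} (hL : HasRank L 1)
  (hε : CechPic.pullback A.unitSection (detClass (HasRank.isFiniteLocallyFree' hL)) = 1)
  (lam : A.X ⟶ D.hat.X) [IsMonHom lam]
  (hlam : ∀ ⦃T : Over S⦄ (u : T ⟶ A.X),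
    Nonempty (D.pullbackP T.hom (u ≫ lam).left (Over.w _) ≅
      (Scheme.Modules.pullback (A.X ◁ u).left).obj (A.mumfordBundle L)))
  {T : Scheme.{u}} [IsLocallyNoetherian T]

section OnePoint

variable [PreconnectedSpace T] (b : T ⟶ S)

include hL hε hlam in
/-- **[MumfordFogartyKirwan1994] Prop. 6.11 for a homomorphism that is `Λ(𝒪(Θ))` at one geometric point** (e.g. a polarisation):
let `T` be connected locally Noetherian, `b : T → S`, `ω : A_T → Â_T` a homomorphism which is `Λ(𝒪(Θ))` at some geometric point
`t` of `T`, and suppose `L_T = pr^*L ≅ Γ^*𝒫 = L^Δ_T(ω^k)` with `Γ = (pr, ω^k ≫ pr_Â)`.  Then `[2k] ≫ ω = Λ(L)_T := (Over.pullback b).map lam`.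
MFK's argument: `Λ(L_T)` is classified by `lam ×_S T` (★ `nonempty_pullbackP_baseChange_iso_pullback_mumfordBundle`), and by
Prop. 6.10 (★ `pullback_map_eq_pullback_map_mul_self` on the fibre at `t`, for `ω^k` with witness `k•Θ`, ★ `IsLambdaOfAt.pow_nsmul`)
`Λ(L^Δ(ω^k)) = 2·ω^k` there; rigidity over the connected base ([MumfordFogartyKirwan1994] Cor. 6.2, ★
`hom_eq_of_pullback_map_eq_of_isLocallyNoetherian`) gives `lam_T = ω^k·ω^k = [2k] ≫ ω`.
[cite: MumfordFogartyKirwan1994, Ch. 6 §2 Prop. 6.11 (p. 122; proof pp. 122–123) and Prop. 6.10 (p. 121)]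
[cite: MumfordFogartyKirwan1994, Ch. 6 §1 Corollary 6.2 (p. 116)] -/
theorem pow_id_comp_eq_pullback_map_of_isLambdaOfAt (ω : (A.baseChange b).X ⟶ (D.hat.baseChange b).X) [IsMonHom ω] (k : ℕ)
    (Γ : (A.baseChange b).left ⟶ A.prodLeft D.hat)
    (hΓ₁ : Γ ≫ pullback.fst A.X.hom D.hat.X.hom = pullback.fst A.X.hom b)
    (hΓ₂ : Γ ≫ pullback.snd A.X.hom D.hat.X.hom = (ω ^ k).left ≫ pullback.fst D.hat.X.hom b)
    (e : Nonempty ((Scheme.Modules.pullback (pullback.fst A.X.hom b)).obj L ≅ (Scheme.Modules.pullback Γ).obj D.P))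
    {Ω : Type u} [Field Ω] [IsAlgClosed Ω] (t : Spec (.of Ω) ⟶ T)
    (hω : ∃ Θ : CartierDivisor ((A.baseChange b).fibre t).toAbelianVariety.X.left,
      (A.baseChange b).IsLambdaOfAt t (D.baseChange b) ω Θ) :
    ((𝟙 (A.baseChange b).X) ^ (2 * k)) ≫ ω = (Over.pullback b).map lam := by
  haveI : IsCommMonObj (D.hat.baseChange b).X := (D.hat.baseChange b).isCommMonObj_of_isLocallyNoetherian_base
  haveI : IsMonHom (ω ^ k) := isMonHom_pow' ω k
  haveI : IsMonHom (ω ^ k * ω ^ k) := by rw [Hom.mul_def]; infer_instance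
  haveI : IsSeparated (D.hat.baseChange b).X.hom := by
    have hp : IsProper (pullback.snd D.hat.X.hom b) := (D.hat.baseChange b).isProper
    change IsSeparated (pullback.snd D.hat.X.hom b)
    infer_instance
  obtain ⟨Θ, hΘ⟩ := hω
  -- the graph `Gr = (1, ω^k) : A_T → A_T ×_T Â_T` of `ω^k` over `T`, and `Γ = Gr ≫ (A_T ×_T Â_T → A ×_S Â)`
  let Gr : (A.baseChange b).X.left ⟶ (A.baseChange b).prodLeft (D.hatBaseChange b) :=
    pullback.lift (𝟙 _) (ω ^ k).left (by rw [Category.id_comp]; exact (Over.w (ω ^ k)).symm)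
  have hGr₁ : Gr ≫ pullback.fst (A.baseChange b).X.hom (D.hatBaseChange b).X.hom = 𝟙 _ := pullback.lift_fst _ _ _
  have hGr₂ : Gr ≫ pullback.snd (A.baseChange b).X.hom (D.hatBaseChange b).X.hom = (ω ^ k).left := pullback.lift_snd _ _ _
  have hΓ : Γ = Gr ≫ D.prodBaseChangeToProd b := by
    apply pullback.hom_ext
    · rw [hΓ₁, Category.assoc, D.prodBaseChangeToProd_fst, ← Category.assoc, hGr₁, Category.id_comp]
    · rw [hΓ₂, Category.assoc, D.prodBaseChangeToProd_snd, ← Category.assoc, hGr₂]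
  -- `M := Gr^*𝒫_T ≅ Γ^*𝒫 ≅ L_T`
  have iM : (Scheme.Modules.pullback Gr).obj (D.baseChange b).P ≅
      (Scheme.Modules.pullback (X := (A.baseChange b).left) (pullback.fst A.X.hom b)).obj L :=
    (Scheme.Modules.pullbackComp Gr (D.prodBaseChangeToProd b)).app D.P ≪≫
      (Scheme.Modules.pullbackCongr hΓ.symm).app D.P ≪≫ (Classical.choice e).symm
  have hM : HasRank ((Scheme.Modules.pullback Gr).obj (D.baseChange b).P) 1 :=
    hasRank_pullback Gr (D.baseChange b).hasRank_one
  have hLT : HasRank ((Scheme.Modules.pullback (X := (A.baseChange b).left) (pullback.fst A.X.hom b)).obj L) 1 :=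
    hasRank_pullback _ hL
  -- `M` is rigidified along `ε_T` (`ε_T ≫ pr = b ≫ ε_A`)
  have hεT : CechPic.pullback (A.baseChange b).unitSection
      (detClass (HasRank.isFiniteLocallyFree' (hasRank_pullback Gr (D.baseChange b).hasRank_one))) = 1 := by
    rw [(detClass_eq_of_iso iM (HasRank.isFiniteLocallyFree' hM)
        ((HasRank.isFiniteLocallyFree' hL).pullback (pullback.fst A.X.hom b))).trans
        (detClass_pullback _ (HasRank.isFiniteLocallyFree' hL)),
      ← CechPic.pullback_comp, A.unitSection_baseChange_comp_fst b, CechPic.pullback_comp, hε, map_one]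
  -- `lam ×_S T` classifies the Mumford family of `M` over `T` (B3d-α, transported along `L_T ≅ M`)
  have hlamT : ∀ ⦃T' : Over T⦄ (u' : T' ⟶ (A.baseChange b).X),
      Nonempty ((D.baseChange b).pullbackP T'.hom (u' ≫ (Over.pullback b).map lam).left (Over.w _) ≅
        (Scheme.Modules.pullback ((A.baseChange b).X ◁ u').left).obj
          ((A.baseChange b).mumfordBundle ((Scheme.Modules.pullback Gr).obj (D.baseChange b).P))) := by
    intro T' u'
    obtain ⟨i⟩ := A.nonempty_pullbackP_baseChange_iso_pullback_mumfordBundle b D hL lam hlam u'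
    obtain ⟨j⟩ := (A.baseChange b).nonempty_mumfordBundle_iso_of_nonempty_iso hLT hM ⟨iM.symm⟩
    exact ⟨i ≪≫ (Scheme.Modules.pullback ((A.baseChange b).X ◁ u').left).mapIso j⟩
  -- Prop. 6.10 on the fibre at `t` for `ω^k`, then rigidity over `T`
  have key := (A.baseChange b).pullback_map_eq_pullback_map_mul_self (D.baseChange b) t (ω ^ k) Gr hGr₁ hGr₂ hεT
    ((Over.pullback b).map lam) hlamT ⟨k • Θ, IsLambdaOfAt.pow_nsmul (A.baseChange b) (D.baseChange b) ω t k hΘ⟩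
  have hlam₂ : (Over.pullback b).map lam = ω ^ k * ω ^ k :=
    (A.baseChange b).hom_eq_of_pullback_map_eq_of_isLocallyNoetherian (G := (D.hat.baseChange b).X)
      ((Over.pullback b).map lam) (ω ^ k * ω ^ k) t key
  rw [hlam₂, ← pow_add, ← two_mul, MonObj.pow_comp, Category.id_comp]

end OnePoint

/-! ## §2 ANY locally Noetherian `T`: `ω` a `Λ(𝒪(Θ_t))` at EVERY geometric point ⟹ `[2k] ≫ ω = Λ(L)_T` -/

variable (b : T ⟶ S)

include hL hε hlam in
/-- **[MumfordFogartyKirwan1994] Prop. 6.11 for a homomorphism that is `Λ(𝒪(Θ_t))` at EVERY geometric point — ANY locally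
Noetherian base `T`** (α-5 edition of `pow_id_comp_eq_pullback_map_of_isLambdaOfAt`; e.g. a polarisation): let `T` be locally
Noetherian, `b : T → S`, `ω : A_T → Â_T` a homomorphism which at every geometric point `t : Spec Ω → T` is `Λ(𝒪(Θ_t))` for some
divisor `Θ_t` on the fibre, and suppose `L_T = pr^*L ≅ Γ^*𝒫 = L^Δ_T(ω^k)` with `Γ = (pr, ω^k ≫ pr_Â)`.  Then
`[2k] ≫ ω = Λ(L)_T := (Over.pullback b).map lam`.  MFK's argument as in §1 gives `lam_T ×_T t = (ω^k·ω^k) ×_T t` at every geometric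
point `t` (★ `nonempty_pullbackP_baseChange_iso_pullback_mumfordBundle`, ★ `pullback_map_eq_pullback_map_mul_self` = Prop. 6.10 on the
fibre, witness `k•Θ_t` by ★ `IsLambdaOfAt.pow_nsmul`); two homomorphisms of abelian schemes over a locally Noetherian base which agree on
every geometric fibre are equal (★ `hom_eq_of_forall_pullback_map_eq_of_isLocallyNoetherian_base`: [MumfordFogartyKirwan1994] Cor. 6.2
on each connected component through Cor. 6.4 at all residue points), whence `lam_T = ω^{2k} = [2k] ≫ ω` without any connectedness of `T`.
[cite: MumfordFogartyKirwan1994, Ch. 6 §2 Prop. 6.11 (p. 122; proof pp. 122–123) and Prop. 6.10 (p. 121)]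
[cite: MumfordFogartyKirwan1994, Ch. 6 §1 Corollary 6.2 (p. 116) and Corollary 6.4 (p. 117)] -/
theorem pow_id_comp_eq_pullback_map_of_forall_isLambdaOfAt (ω : (A.baseChange b).X ⟶ (D.hat.baseChange b).X) [IsMonHom ω]
    (k : ℕ) (Γ : (A.baseChange b).left ⟶ A.prodLeft D.hat)
    (hΓ₁ : Γ ≫ pullback.fst A.X.hom D.hat.X.hom = pullback.fst A.X.hom b)
    (hΓ₂ : Γ ≫ pullback.snd A.X.hom D.hat.X.hom = (ω ^ k).left ≫ pullback.fst D.hat.X.hom b)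
    (e : Nonempty ((Scheme.Modules.pullback (pullback.fst A.X.hom b)).obj L ≅ (Scheme.Modules.pullback Γ).obj D.P))
    (hω : ∀ (Ω : Type u) [Field Ω] [IsAlgClosed Ω] (t : Spec (.of Ω) ⟶ T),
      ∃ Θ : CartierDivisor ((A.baseChange b).fibre t).toAbelianVariety.X.left,
        (A.baseChange b).IsLambdaOfAt t (D.baseChange b) ω Θ) :
    ((𝟙 (A.baseChange b).X) ^ (2 * k)) ≫ ω = (Over.pullback b).map lam := by
  haveI : IsCommMonObj (D.hat.baseChange b).X := (D.hat.baseChange b).isCommMonObj_of_isLocallyNoetherian_base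
  haveI : IsMonHom (ω ^ k) := isMonHom_pow' ω k
  haveI : IsMonHom (ω ^ k * ω ^ k) := by rw [Hom.mul_def]; infer_instance
  -- the graph `Gr = (1, ω^k) : A_T → A_T ×_T Â_T` of `ω^k` over `T`, and `Γ = Gr ≫ (A_T ×_T Â_T → A ×_S Â)`
  let Gr : (A.baseChange b).X.left ⟶ (A.baseChange b).prodLeft (D.hatBaseChange b) :=
    pullback.lift (𝟙 _) (ω ^ k).left (by rw [Category.id_comp]; exact (Over.w (ω ^ k)).symm)
  have hGr₁ : Gr ≫ pullback.fst (A.baseChange b).X.hom (D.hatBaseChange b).X.hom = 𝟙 _ := pullback.lift_fst _ _ _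
  have hGr₂ : Gr ≫ pullback.snd (A.baseChange b).X.hom (D.hatBaseChange b).X.hom = (ω ^ k).left := pullback.lift_snd _ _ _
  have hΓ : Γ = Gr ≫ D.prodBaseChangeToProd b := by
    apply pullback.hom_ext
    · rw [hΓ₁, Category.assoc, D.prodBaseChangeToProd_fst, ← Category.assoc, hGr₁, Category.id_comp]
    · rw [hΓ₂, Category.assoc, D.prodBaseChangeToProd_snd, ← Category.assoc, hGr₂]
  -- `M := Gr^*𝒫_T ≅ Γ^*𝒫 ≅ L_T`
  have iM : (Scheme.Modules.pullback Gr).obj (D.baseChange b).P ≅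
      (Scheme.Modules.pullback (X := (A.baseChange b).left) (pullback.fst A.X.hom b)).obj L :=
    (Scheme.Modules.pullbackComp Gr (D.prodBaseChangeToProd b)).app D.P ≪≫
      (Scheme.Modules.pullbackCongr hΓ.symm).app D.P ≪≫ (Classical.choice e).symm
  have hM : HasRank ((Scheme.Modules.pullback Gr).obj (D.baseChange b).P) 1 :=
    hasRank_pullback Gr (D.baseChange b).hasRank_one
  have hLT : HasRank ((Scheme.Modules.pullback (X := (A.baseChange b).left) (pullback.fst A.X.hom b)).obj L) 1 :=
    hasRank_pullback _ hL
  -- `M` is rigidified along `ε_T` (`ε_T ≫ pr = b ≫ ε_A`)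
  have hεT : CechPic.pullback (A.baseChange b).unitSection
      (detClass (HasRank.isFiniteLocallyFree' (hasRank_pullback Gr (D.baseChange b).hasRank_one))) = 1 := by
    rw [(detClass_eq_of_iso iM (HasRank.isFiniteLocallyFree' hM)
        ((HasRank.isFiniteLocallyFree' hL).pullback (pullback.fst A.X.hom b))).trans
        (detClass_pullback _ (HasRank.isFiniteLocallyFree' hL)),
      ← CechPic.pullback_comp, A.unitSection_baseChange_comp_fst b, CechPic.pullback_comp, hε, map_one]
  -- `lam ×_S T` classifies the Mumford family of `M` over `T` (B3d-α, transported along `L_T ≅ M`)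
  have hlamT : ∀ ⦃T' : Over T⦄ (u' : T' ⟶ (A.baseChange b).X),
      Nonempty ((D.baseChange b).pullbackP T'.hom (u' ≫ (Over.pullback b).map lam).left (Over.w _) ≅
        (Scheme.Modules.pullback ((A.baseChange b).X ◁ u').left).obj
          ((A.baseChange b).mumfordBundle ((Scheme.Modules.pullback Gr).obj (D.baseChange b).P))) := by
    intro T' u'
    obtain ⟨i⟩ := A.nonempty_pullbackP_baseChange_iso_pullback_mumfordBundle b D hL lam hlam u'
    obtain ⟨j⟩ := (A.baseChange b).nonempty_mumfordBundle_iso_of_nonempty_iso hLT hM ⟨iM.symm⟩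
    exact ⟨i ≪≫ (Scheme.Modules.pullback ((A.baseChange b).X ◁ u').left).mapIso j⟩
  -- Prop. 6.10 on EVERY geometric fibre for `ω^k`, then rigidity over the locally Noetherian `T` by agreement on geometric fibres
  have hlam₂ : (Over.pullback b).map lam = ω ^ k * ω ^ k :=
    hom_eq_of_forall_pullback_map_eq_of_isLocallyNoetherian_base (A := A.baseChange b) (B := D.hat.baseChange b)
      ((Over.pullback b).map lam) (ω ^ k * ω ^ k) fun Ω _ _ t => by
        obtain ⟨Θ, hΘ⟩ := hω Ω t
        exact (A.baseChange b).pullback_map_eq_pullback_map_mul_self (D.baseChange b) t (ω ^ k) Gr hGr₁ hGr₂ hεT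
          ((Over.pullback b).map lam) hlamT ⟨k • Θ, IsLambdaOfAt.pow_nsmul (A.baseChange b) (D.baseChange b) ω t k hΘ⟩
  rw [hlam₂, ← pow_add, ← two_mul, MonObj.pow_comp, Category.id_comp]

/-! ## §3 Polarisations — ANY locally Noetherian `T` -/

include hL hε hlam in
/-- **Prop. 6.11 for a POLARISATION of `A_T` — ANY locally Noetherian `T`** ([MumfordFogartyKirwan1994] Prop. 6.11 with Prop. 6.10;
Prop. 7.3 step (V)): for `T` locally Noetherian (the first edition assumed `T` nonempty connected), `b : T → S`, a polarisation `pol`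
of `(A_T, Â_T, 𝒫_T)` and `k : ℕ` with `L_T ≅ Γ^*𝒫 = L^Δ_T(pol.lam^k)`, one has `[2k] ≫ pol.lam = Λ(L)_T` — the descent clause of the
homomorphism form ★ `exists_isClosedImmersion_iff_exists_LDelta` is automatic for polarisations (§2 with the ample witnesses of `pol`
at every geometric point, ★ `Polarization.exists_ample`).
[cite: MumfordFogartyKirwan1994, Ch. 6 §2 Prop. 6.11 (p. 122; proof pp. 122–123) and Prop. 6.10 (p. 121)]
[cite: MumfordFogartyKirwan1994, Ch. 7 §2 Proposition 7.3 (pp. 132–134)] -/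
theorem pow_id_comp_eq_pullback_map_of_polarization (pol : (A.baseChange b).Polarization (D.baseChange b))
    (k : ℕ) (Γ : (A.baseChange b).left ⟶ A.prodLeft D.hat)
    (hΓ₁ : Γ ≫ pullback.fst A.X.hom D.hat.X.hom = pullback.fst A.X.hom b)
    (hΓ₂ : Γ ≫ pullback.snd A.X.hom D.hat.X.hom = (pol.lam ^ k).left ≫ pullback.fst D.hat.X.hom b)
    (e : Nonempty ((Scheme.Modules.pullback (pullback.fst A.X.hom b)).obj L ≅ (Scheme.Modules.pullback Γ).obj D.P)) :
    ((𝟙 (A.baseChange b).X) ^ (2 * k)) ≫ pol.lam = (Over.pullback b).map lam := by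
  haveI := pol.isMonHom
  refine A.pow_id_comp_eq_pullback_map_of_forall_isLambdaOfAt D hL hε lam hlam b pol.lam k Γ hΓ₁ hΓ₂ e fun Ω _ _ t => ?_
  obtain ⟨Θ, -, hΘ⟩ := pol.exists_ample Ω t
  exact ⟨Θ, hΘ⟩

include hL hε hlam in
/-- **Polarized objects lie in the locus of Prop. 6.11 — ANY locally Noetherian `T`** ([MumfordFogartyKirwan1994] Prop. 7.3 step
(V): «if the induced abelian scheme … comes from a polarized … abelian scheme, then that polarization `ω̄_S` must satisfy
`L′₄ ⊗ 𝒪_S ≅ L^Δ(ω̄_S)^3`» — and then `S → H₄` factors through `H₅`): under the hypotheses of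
`pow_id_comp_eq_pullback_map_of_polarization` (no connectedness or nonemptiness of `T` in this edition), the right-hand side of ★
`exists_isClosedImmersion_iff_exists_LDelta` holds at `b` with `m = pol.lam`; hence `b` factors through the closed subscheme
`j : Z ↪ S` of that theorem. [cite: MumfordFogartyKirwan1994, Ch. 6 §2 Prop. 6.11 (p. 122; proof pp. 122–123)]
[cite: MumfordFogartyKirwan1994, Ch. 7 §2 Proposition 7.3 (pp. 132–134)] -/
theorem exists_LDelta_of_polarization (pol : (A.baseChange b).Polarization (D.baseChange b))
    (k : ℕ) (Γ : (A.baseChange b).left ⟶ A.prodLeft D.hat)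
    (hΓ₁ : Γ ≫ pullback.fst A.X.hom D.hat.X.hom = pullback.fst A.X.hom b)
    (hΓ₂ : Γ ≫ pullback.snd A.X.hom D.hat.X.hom = (pol.lam ^ k).left ≫ pullback.fst D.hat.X.hom b)
    (e : Nonempty ((Scheme.Modules.pullback (pullback.fst A.X.hom b)).obj L ≅ (Scheme.Modules.pullback Γ).obj D.P)) :
    ∃ (m : (A.baseChange b).X ⟶ (D.hat.baseChange b).X) (Γ : (A.baseChange b).left ⟶ A.prodLeft D.hat),
      IsMonHom m ∧ ((𝟙 (A.baseChange b).X) ^ (2 * k)) ≫ m = (Over.pullback b).map lam ∧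
        Γ ≫ pullback.fst A.X.hom D.hat.X.hom = pullback.fst A.X.hom b ∧
        Γ ≫ pullback.snd A.X.hom D.hat.X.hom = (m ^ k).left ≫ pullback.fst D.hat.X.hom b ∧
        Nonempty ((Scheme.Modules.pullback (pullback.fst A.X.hom b)).obj L ≅ (Scheme.Modules.pullback Γ).obj D.P) :=
  ⟨pol.lam, Γ, pol.isMonHom, A.pow_id_comp_eq_pullback_map_of_polarization D hL hε lam hlam b pol k Γ hΓ₁ hΓ₂ e, hΓ₁, hΓ₂, e⟩

end AbelianSchemeOver

end Literature.AlgebraicGeometry.AbelianSchemes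

end
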